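import Literature.NumberTheory.QuadraticForms.HilbertSymbolRegularLocal
import Literature.NumberTheory.QuadraticForms.QuadraticNormIndex
import Literature.NumberTheory.AdelicBaseChange.CompletionBaseChange
import Mathlib.Algebra.QuadraticAlgebra.NormDeterminant
import Mathlib.RingTheory.Norm.Transitivity
import HarnessLib

/-!
# The projection formula `(θ, b)_K = (θ, N_{K/F} b)_F` for the quadratic Hilbert symbol in ODD or QUADRATIC degree,
# and the fibre identity `∏_{w ∣ v} (θ, b_w)_{L_w} = (θ, ∏_{w ∣ v} N_{L_w/K_v} b_w)_{K_v}` for `[L : K] ≤ 3`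

Topic `NumberTheory/QuadraticForms`; namespace `Literature.NumberTheory.QuadraticForms`.  THEOREMS ONLY (no definition, no named fact,
no instance, no `sorry`); elementary: NO local class field theory, no global road — only the bilinearity and non-degeneracy of the local
symbol (`IsRegularHilbertField`, ★ `isRegularHilbertField_adicCompletion`, O'Meara 63:13a/63:19/63:20) and the transitivity of the norm.
The general projection formula (Neukirch IV (6.4) + V (3.1)–(3.2)) is local class field theory and is in the tree over `ℚ₂`/`ℚ` only
(`HilbertSymbolNormCompatAtTwo{,Completion,Holds}`); for `[K : F] ∈ {1, 2, 3}` — the local degrees of the field factors of an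
étale CUBIC algebra, e.g. the Cartan subalgebras of `U(3)` [Rogawski1990, §3.5–3.6] — it is elementary:
* §1 `exists_norm_sq_sub_mul_sq_eq`, `norm_mem_quadraticNormSubgroup`: **norms of norms are norms**, `N_{K/F}(N(K[√θ]ˣ)) ⊆ N(F[√θ]ˣ)`
  (Mathlib `QuadraticAlgebra`, `Algebra.norm_norm`), whence `(θ, b)_K = 1 ⟹ (θ, N_{K/F} b)_F = 1` (`hilbertSymbol_norm_eq_one_of_eq_one`);
* §2 REGULAR Hilbert fields `F ⊆ K`: `N(F[√θ]ˣ)` has index `2` for `θ ∉ F²`; for `θ ∉ K²` the character `b ↦ (θ, N_{K/F} b)_F` of `Kˣ`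
  is non-trivial when `[K : F]` is ODD (`N a = a^{[K:F]}`) or `= 2` (`K ≅ F[ω]/(ω² − η)`: else `N(F[√η]ˣ) = N(F[√θ]ˣ)`, `ηθ ∈ F²`,
  `θ ∈ K²`); two index-`2` subgroups one inside the other coincide ⟹ **`IsRegularHilbertField.hilbertSymbol_eq_hilbertSymbol_norm`**;
* §3 completions `w ∣ v` of number fields `K ⊆ L` (FLT base change ★ `CompletionBaseChange`, `Σ_{w∣v} [L_w : K_v] = [L : K]`):
  `hilbertSymbol_adicCompletion_eq_hilbertSymbol_norm`, `odd_or_eq_two_finrank_adicCompletion_of_finrank_le_three` and the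
  **fibre identity** `prod_hilbertSymbol_adicCompletion_eq_hilbertSymbol_prod_norm` (`[L : K] ≤ 3`).

USE (cell hodgecm-mathlib, engine T1 row G6, `Rogawski1990/CartanObstruction` / `CartanObsHasse`): the local Cartan invariants
`c_v ∈ (K⁺ ⊗ F_v)ˣ` of an adelic element of a regular stable class have `(θ, N c_v)_{F_v} = 1` (`N c_v = N_{L_v/F_v}(det g_v)`); the fibre
identity gives `∏_{i, w ∣ v} (θ, c_{i,w})_{(Kᵢ)_w} = 1`: the obstruction vector lies in the SUM-ZERO HYPERPLANE `𝔈(T/F)` of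
[Rogawski1990, Prop. 3.5.2 (c)], whence `|𝓡(T/F)| = 2^{r−1} = 1 + #{𝒪_H ↦ 𝒪}`.  HC_CM is proved only modulo the printed citations until
rung 0 closes; this file is quadratic-form algebra and asserts nothing about unitary groups.

## References
* [Omeara1963] O. T. O'Meara, *Introduction to Quadratic Forms* (1963), §63B (63:10), §63C (63:13a, 63:19, 63:20).
* [Serre1973] J.-P. Serre, *A Course in Arithmetic* (1973), Ch. III §1.2 Thm 2.
* [NeukirchANT1999] J. Neukirch, *Algebraic Number Theory* (1999), Ch. IV (6.4), Ch. V (3.1)–(3.2).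
* [CasselsFrohlichANT1967] Cassels–Fröhlich (eds.), *Algebraic Number Theory* (1967), Ch. II §10 (10.2).
* [Rogawski1990] J. D. Rogawski, *Automorphic Representations of Unitary Groups in Three Variables* (1990), §3.5 Prop. 3.5.2 (c), §3.6.
-/

set_option autoImplicit false

noncomputable section

open scoped TensorProduct

namespace Literature.NumberTheory.QuadraticForms

/-! ## §1 Norms of binary norm forms: `N_{K/F}(x² − θ y²) = s² − θ t²` -/

section QuadraticAlgebraNorm

variable {R : Type*} [CommRing R] (a b : R)

/-- `Algebra.norm` on the quadratic algebra `R[ω]/(ω² − a − bω)` is its norm form. [folklore] -/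
private theorem algebraNorm_quadraticAlgebra (z : QuadraticAlgebra R a b) : Algebra.norm R z = z.norm := by
  rw [Algebra.norm_apply, ← QuadraticAlgebra.det_toLinearMap_eq_norm]
  congr 1

end QuadraticAlgebraNorm

section Tower

variable {F K : Type*} [Field F] [Field K] [Algebra F K] [FiniteDimensional F K]

/-- **The norm of a binary norm form is a binary norm form**: for a finite extension of fields `K/F`, `θ ∈ F`, `x, y ∈ K` there
are `s, t ∈ F` with `N_{K/F}(x² − θ y²) = s² − θ t²` (`x² − θ y² = N_{K[ε]/K}(x + yε)`, `ε² = θ`, and `N_{K/F} ∘ N_{K[ε]/K} = N_{K[ε]/F} =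
N_{F[ε]/F} ∘ N_{K[ε]/F[ε]}`: Mathlib `Algebra.norm_norm` in the towers `F ⊆ K ⊆ K[ε]`, `F ⊆ F[ε] ⊆ F[ε] ⊗_F K ≅ K[ε]`). [cite: Omeara1963, §63B (63:10)] -/
theorem exists_norm_sq_sub_mul_sq_eq (θ : F) (x y : K) :
    ∃ s t : F, Algebra.norm F (x ^ 2 - algebraMap F K θ * y ^ 2) = s ^ 2 - θ * t ^ 2 := by
  let z : QuadraticAlgebra K (algebraMap F K θ) 0 := ⟨x, y⟩
  have hz : Algebra.norm K z = x ^ 2 - algebraMap F K θ * y ^ 2 := by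
    rw [algebraNorm_quadraticAlgebra, QuadraticAlgebra.norm_def]; ring
  haveI : FiniteDimensional F (QuadraticAlgebra K (algebraMap F K θ) 0) := Module.Finite.trans K (QuadraticAlgebra K (algebraMap F K θ) 0)
  have h1 : Algebra.norm F (Algebra.norm K z) = Algebra.norm F z := Algebra.norm_norm
  have hω : (QuadraticAlgebra.omega : QuadraticAlgebra K (algebraMap F K θ) 0) * QuadraticAlgebra.omega =
      θ • (1 : QuadraticAlgebra K (algebraMap F K θ) 0) + (0 : F) • QuadraticAlgebra.omega := by
    rw [QuadraticAlgebra.omega_mul_omega_eq_mk, zero_smul, add_zero,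
      show (1 : QuadraticAlgebra K (algebraMap F K θ) 0) = ⟨1, 0⟩ from rfl, QuadraticAlgebra.smul_mk, smul_zero,
      Algebra.smul_def, mul_one]
  let e₀ : QuadraticAlgebra F θ 0 ⊗[F] K →ₐ[F] QuadraticAlgebra K (algebraMap F K θ) 0 :=
    Algebra.TensorProduct.lift (QuadraticAlgebra.lift ⟨QuadraticAlgebra.omega, hω⟩)
      (IsScalarTower.toAlgHom F K (QuadraticAlgebra K (algebraMap F K θ) 0)) (fun _ _ => Commute.all _ _)
  have hsurj : Function.Surjective e₀ := by
    intro w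
    refine ⟨(1 : QuadraticAlgebra F θ 0) ⊗ₜ[F] w.re + QuadraticAlgebra.omega ⊗ₜ[F] w.im, ?_⟩
    rw [map_add, Algebra.TensorProduct.lift_tmul, Algebra.TensorProduct.lift_tmul, map_one, one_mul]
    change algebraMap K _ w.re + (QuadraticAlgebra.lift ⟨QuadraticAlgebra.omega, hω⟩ QuadraticAlgebra.omega) *
      algebraMap K _ w.im = w
    rw [QuadraticAlgebra.lift_apply_apply, QuadraticAlgebra.omega_re, QuadraticAlgebra.omega_im, zero_smul, zero_add, one_smul]
    ext <;> simp
  have hdim : Module.finrank F (QuadraticAlgebra F θ 0 ⊗[F] K) = Module.finrank F (QuadraticAlgebra K (algebraMap F K θ) 0) := by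
    rw [Module.finrank_tensorProduct, QuadraticAlgebra.finrank_eq_two, ← Module.finrank_mul_finrank F K (QuadraticAlgebra K (algebraMap F K θ) 0),
      QuadraticAlgebra.finrank_eq_two, mul_comm]
  let e : QuadraticAlgebra F θ 0 ⊗[F] K ≃ₐ[F] QuadraticAlgebra K (algebraMap F K θ) 0 := AlgEquiv.ofBijective e₀
    ⟨(LinearMap.injective_iff_surjective_of_finrank_eq_finrank hdim (f := e₀.toLinearMap)).2 hsurj, hsurj⟩
  have h2 : Algebra.norm F z = Algebra.norm F (e.symm z) := by
    conv_lhs => rw [← e.apply_symm_apply z]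
    exact Algebra.norm_eq_of_algEquiv e (e.symm z)
  have h3 : Algebra.norm F (e.symm z) = Algebra.norm F (Algebra.norm (QuadraticAlgebra F θ 0) (e.symm z)) := Algebra.norm_norm.symm
  refine ⟨(Algebra.norm (QuadraticAlgebra F θ 0) (e.symm z)).re, (Algebra.norm (QuadraticAlgebra F θ 0) (e.symm z)).im, ?_⟩
  rw [← hz, h1, h2, h3, algebraNorm_quadraticAlgebra, QuadraticAlgebra.norm_def]
  ring

/-- Consequently **`N_{K/F}` maps the norm group of `K[√θ]` into the norm group of `F[√θ]`**:
`t ∈ N(K[√θ]ˣ) ⟹ N_{K/F} t ∈ N(F[√θ]ˣ)` (the tree's `quadraticNormSubgroup`). [cite: Omeara1963, §63B (63:10)] -/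
theorem norm_mem_quadraticNormSubgroup {θ : F} {t : Kˣ} (ht : t ∈ quadraticNormSubgroup K (algebraMap F K θ)) :
    Units.map (Algebra.norm F : K →* F) t ∈ quadraticNormSubgroup F θ := by
  obtain ⟨x, y, hxy⟩ := ht
  obtain ⟨s, u, hsu⟩ := exists_norm_sq_sub_mul_sq_eq θ x y
  exact ⟨s, u, by rw [Units.coe_map, ← hxy, hsu]⟩

end Tower

/-! ## §2 Regular Hilbert fields: the projection formula in odd degree and in degree two -/

section Regular

variable {F : Type*} [Field F]

/-- Over a field with a bilinear nondegenerate Hilbert symbol, the norm group `N(F[√θ]ˣ) = {c : (c, θ)_F = 1}` of a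
NON-SQUARE `θ ≠ 0` has index `2` in `Fˣ`. [cite: Serre1973, Ch. III §1.2 Thm 2] -/
theorem IsRegularHilbertField.index_quadraticNormSubgroup_eq_two (hF : IsRegularHilbertField F) {θ : F}
    (hθ0 : θ ≠ 0) (hθ : ¬ IsSquare θ) : (quadraticNormSubgroup F θ).index = 2 := by
  haveI : NeZero (2 : F) := ⟨hF.two_ne_zero⟩
  obtain ⟨a, ha0, ha⟩ := hF.exists_eq_neg_one θ hθ0 hθ
  rw [Subgroup.index_eq_two_iff]
  refine ⟨Units.mk0 a ha0, fun c => ?_⟩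
  have hc : hilbertSymbol F (c : F) θ = 1 ∨ hilbertSymbol F (c : F) θ = -1 := hilbertSymbol_eq_one_or_eq_neg_one _ _
  rw [← hilbertSymbol_eq_one_iff_mem_quadraticNormSubgroup hθ0, ← hilbertSymbol_eq_one_iff_mem_quadraticNormSubgroup hθ0,
    Units.val_mul, Units.val_mk0, hF.mul_left _ _ _ c.ne_zero ha0 hθ0, ha]
  rcases hc with hc | hc <;> simp [hc]

/-- Two subgroups of index `2`, one inside the other, are equal. [folklore] -/
private theorem Subgroup.eq_of_le_of_index_eq_two {G : Type*} [Group G] {H H' : Subgroup G} (hle : H ≤ H') (hH : H.index = 2)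
    (hH' : H'.index = 2) : H = H' := by
  have h := Subgroup.relIndex_mul_index hle
  rw [hH, hH'] at h
  exact le_antisymm hle (Subgroup.relIndex_eq_one.1 (by omega))

variable {K : Type*} [Field K] [Algebra F K] [FiniteDimensional F K]

/-- **The easy half of the projection formula**: if `b ∈ Kˣ` is a norm from `K[√θ]` (`(θ, b)_K = 1`), then `N_{K/F} b` is a
norm from `F[√θ]` (`(θ, N_{K/F} b)_F = 1`) — over any fields of characteristic `≠ 2`. [cite: Omeara1963, §63B (63:10)] -/
theorem hilbertSymbol_norm_eq_one_of_eq_one [NeZero (2 : F)] [NeZero (2 : K)] {θ : F} (hθ : θ ≠ 0) {b : K} (hb : b ≠ 0)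
    (h : hilbertSymbol K (algebraMap F K θ) b = 1) : hilbertSymbol F θ (Algebra.norm F b) = 1 := by
  have hθ' : algebraMap F K θ ≠ 0 := (map_ne_zero _).2 hθ
  rw [hilbertSymbol_comm] at h
  have hm : Units.mk0 b hb ∈ quadraticNormSubgroup K (algebraMap F K θ) :=
    (hilbertSymbol_eq_one_iff_mem_quadraticNormSubgroup hθ' (Units.mk0 b hb)).1 h
  have h' := (hilbertSymbol_eq_one_iff_mem_quadraticNormSubgroup hθ _).2 (norm_mem_quadraticNormSubgroup hm)
  rwa [hilbertSymbol_comm, Units.coe_map, Units.val_mk0] at h'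

/-- `(a, c ^ n)_F = (a, c)_F` for `n` odd (pull out the even power as a square). [folklore] -/
private theorem hilbertSymbol_pow_right_of_odd (a : F) {c : F} (hc : c ≠ 0) {n : ℕ} (hn : Odd n) :
    hilbertSymbol F a (c ^ n) = hilbertSymbol F a c := by
  obtain ⟨k, rfl⟩ := hn
  rw [show c ^ (2 * k + 1) = c * (c ^ k) ^ 2 by ring, hilbertSymbol_mul_sq_right _ _ (pow_ne_zero _ hc)]

/-- Odd degree: if `θ ∈ F` is not a square in `F`, some `z ∈ Kˣ` has `(θ, N_{K/F} z)_F = -1` — namely `z = a ∈ F` with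
`(θ, a)_F = -1`, `N_{K/F} a = a^{[K:F]}`. [cite: Serre1973, Ch. III §1.2 Thm 2] -/
theorem IsRegularHilbertField.exists_hilbertSymbol_norm_eq_neg_one_of_odd (hF : IsRegularHilbertField F) {θ : F} (hθ0 : θ ≠ 0)
    (hθ : ¬ IsSquare θ) (hodd : Odd (Module.finrank F K)) :
    ∃ z : K, z ≠ 0 ∧ hilbertSymbol F θ (Algebra.norm F z) = -1 := by
  obtain ⟨a, ha0, ha⟩ := hF.exists_eq_neg_one θ hθ0 hθ
  refine ⟨algebraMap F K a, (map_ne_zero _).2 ha0, ?_⟩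
  rw [Algebra.norm_algebraMap, hilbertSymbol_pow_right_of_odd _ ha0 hodd, hilbertSymbol_comm, ha]

/-- In degree two, `K ≃ F[ω]/(ω² − η)` for some `η ∈ F` (complete the square; `char F ≠ 2`). [folklore] -/
private theorem exists_algEquiv_quadraticAlgebra_of_finrank_eq_two [NeZero (2 : F)] (h2 : Module.finrank F K = 2) :
    ∃ η : F, Nonempty (QuadraticAlgebra F η 0 ≃ₐ[F] K) := by
  -- an element `α ∉ F`
  have hbt : (⊥ : Subalgebra F K) ≠ ⊤ := by
    rw [Ne, Subalgebra.bot_eq_top_iff_finrank_eq_one, h2]; norm_num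
  obtain ⟨α, -, hα⟩ : ∃ α ∈ (⊤ : Subalgebra F K), α ∉ (⊥ : Subalgebra F K) := SetLike.exists_of_lt (lt_of_le_of_ne bot_le hbt)
  rw [Algebra.mem_bot] at hα
  -- `α² = p + q α`
  have hdep : ¬ LinearIndependent F ![(1 : K), α, α ^ 2] := by
    intro hli
    have := hli.fintype_card_le_finrank
    rw [Fintype.card_fin, h2] at this
    omega
  rw [Fintype.not_linearIndependent_iff] at hdep
  obtain ⟨g, hg, i, hi⟩ := hdep
  rw [Fin.sum_univ_three] at hg
  simp only [Matrix.cons_val_zero, Matrix.cons_val_one, Matrix.cons_val] at hg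
  have hg2 : g 2 ≠ 0 := by
    intro h0
    rw [h0, zero_smul, add_zero] at hg
    by_cases h1 : g 1 = 0
    · rw [h1, zero_smul, add_zero, smul_eq_zero] at hg
      have h00 : g 0 = 0 := hg.resolve_right one_ne_zero
      fin_cases i <;> simp_all
    · apply hα
      refine ⟨-(g 0) / g 1, ?_⟩
      rw [map_div₀, map_neg, div_eq_iff ((map_ne_zero _).2 h1), eq_comm, ← sub_eq_zero]
      rw [Algebra.smul_def, Algebra.smul_def, mul_one] at hg
      rw [← hg]; ring
  -- `β := 2α + q` has `β² = η := q² − 4p ∈ F`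
  set q : F := g 1 / g 2 with hq
  set p : F := g 0 / g 2 with hp
  have hα2 : α ^ 2 = -(algebraMap F K p) - algebraMap F K q * α := by
    have : (g 2)⁻¹ • (g 0 • (1 : K) + g 1 • α + g 2 • α ^ 2) = 0 := by rw [hg, smul_zero]
    rw [smul_add, smul_add, smul_smul, smul_smul, smul_smul, inv_mul_cancel₀ hg2, one_smul] at this
    rw [hp, hq, div_eq_inv_mul, div_eq_inv_mul, Algebra.smul_def, Algebra.smul_def, mul_one] at *
    linear_combination this
  set β : K := 2 * α + algebraMap F K q with hβ
  set η : F := q ^ 2 - 4 * p with hη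
  have h2K : (2 : K) ≠ 0 := by rw [← map_ofNat (algebraMap F K) 2]; exact (map_ne_zero _).2 two_ne_zero
  have hβ2 : β * β = η • (1 : K) + (0 : F) • β := by
    rw [zero_smul, add_zero, Algebra.smul_def, mul_one, hβ, hη]
    simp only [map_sub, map_mul, map_pow, map_ofNat]
    linear_combination (4 : K) * hα2
  let φ : QuadraticAlgebra F η 0 →ₐ[F] K := QuadraticAlgebra.lift ⟨β, hβ2⟩
  have hβF : ∀ r : F, algebraMap F K r ≠ β := by
    refine fun r hr => hα ⟨(r - q) / 2, ?_⟩
    rw [hβ] at hr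
    rw [map_div₀, map_sub, map_ofNat, div_eq_iff h2K]
    linear_combination hr
  have hinj : Function.Injective φ := by
    rw [injective_iff_map_eq_zero]
    intro z hz
    rw [QuadraticAlgebra.lift_apply_apply] at hz
    by_cases hzi : z.im = 0
    · rw [hzi, zero_smul, add_zero, smul_eq_zero] at hz
      exact QuadraticAlgebra.ext (hz.resolve_right one_ne_zero) hzi
    · refine absurd ?_ (hβF (-(z.re / z.im)))
      rw [Algebra.smul_def, Algebra.smul_def, mul_one] at hz
      dsimp only at hz
      rw [map_neg, map_div₀, neg_eq_iff_eq_neg, div_eq_iff ((map_ne_zero _).2 hzi)]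
      linear_combination hz
  have hdim : Module.finrank F (QuadraticAlgebra F η 0) = Module.finrank F K := by rw [QuadraticAlgebra.finrank_eq_two, h2]
  exact ⟨η, ⟨AlgEquiv.ofBijective φ
    ⟨hinj, (LinearMap.injective_iff_surjective_of_finrank_eq_finrank hdim (f := φ.toLinearMap)).1 hinj⟩⟩⟩

/-- Degree two: if `θ ∈ F` is not a square in `K`, some `z ∈ Kˣ` has `(θ, N_{K/F} z)_F = -1` (otherwise the two index-`2`
norm groups `N(Kˣ) = N(F[√η]ˣ)` and `N(F[√θ]ˣ)` of `Fˣ` coincide, so `(·, ηθ)_F ≡ 1`, `ηθ ∈ F²` and `θ ∈ η F² ⊆ K²`).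
[cite: Serre1973, Ch. III §1.2 Thm 2] -/
theorem IsRegularHilbertField.exists_hilbertSymbol_norm_eq_neg_one_of_finrank_eq_two (hF : IsRegularHilbertField F) {θ : F}
    (hθ0 : θ ≠ 0) (hθK : ¬ IsSquare (algebraMap F K θ)) (h2 : Module.finrank F K = 2) :
    ∃ z : K, z ≠ 0 ∧ hilbertSymbol F θ (Algebra.norm F z) = -1 := by
  haveI : NeZero (2 : F) := ⟨hF.two_ne_zero⟩
  obtain ⟨η, ⟨e⟩⟩ := exists_algEquiv_quadraticAlgebra_of_finrank_eq_two (F := F) (K := K) h2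
  have hθ : ¬ IsSquare θ := fun ⟨s, hs⟩ => hθK ⟨algebraMap F K s, by rw [hs, map_mul]⟩
  have hη : ¬ IsSquare η := by
    rintro ⟨d, hd⟩
    have hzero : (⟨d, 1⟩ : QuadraticAlgebra F η 0) * ⟨d, -1⟩ = 0 := by
      ext <;> simp [QuadraticAlgebra.mk_mul_mk, hd]
    have := congrArg e hzero
    rw [map_mul, map_zero, mul_eq_zero] at this
    rcases this with h | h <;>
    · have h' := congrArg QuadraticAlgebra.im (e.injective (h.trans (map_zero e).symm))
      simp at h'
  have hη0 : η ≠ 0 := fun h => hη (h ▸ IsSquare.zero)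
  have hnorm : ∀ w : QuadraticAlgebra F η 0, Algebra.norm F (e w) = w.re ^ 2 - η * w.im ^ 2 := by
    intro w
    rw [Algebra.norm_eq_of_algEquiv, algebraNorm_quadraticAlgebra, QuadraticAlgebra.norm_def]; ring
  by_contra hcon
  have hall : ∀ z : K, z ≠ 0 → hilbertSymbol F θ (Algebra.norm F z) = 1 := fun z hz =>
    (hilbertSymbol_eq_one_or_eq_neg_one _ _).resolve_right fun hneg => hcon ⟨z, hz, hneg⟩
  have hle : quadraticNormSubgroup F η ≤ quadraticNormSubgroup F θ := by
    intro c hc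
    obtain ⟨u, v, huv⟩ := hc
    have hw0 : e ⟨u, v⟩ ≠ 0 := fun h0 => c.ne_zero <| by
      rw [← huv, ← Algebra.norm_zero (R := F) (S := K), ← h0, hnorm]
    have h1 := hall _ hw0
    rw [hnorm, huv, hilbertSymbol_comm] at h1
    exact (hilbertSymbol_eq_one_iff_mem_quadraticNormSubgroup hθ0 c).1 h1
  have heq := Subgroup.eq_of_le_of_index_eq_two hle (hF.index_quadraticNormSubgroup_eq_two hη0 hη)
    (hF.index_quadraticNormSubgroup_eq_two hθ0 hθ)
  have hsq : IsSquare (η * θ) := by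
    by_contra hns
    obtain ⟨c, hc0, hc⟩ := hF.exists_eq_neg_one (η * θ) (mul_ne_zero hη0 hθ0) hns
    have hcη : hilbertSymbol F c η = hilbertSymbol F c θ := by
      have h1 := hilbertSymbol_eq_one_iff_mem_quadraticNormSubgroup hη0 (Units.mk0 c hc0)
      have h2 := hilbertSymbol_eq_one_iff_mem_quadraticNormSubgroup hθ0 (Units.mk0 c hc0)
      rw [Units.val_mk0] at h1 h2
      rw [heq] at h1
      rcases hilbertSymbol_eq_one_or_eq_neg_one c η with h | h <;>
        rcases hilbertSymbol_eq_one_or_eq_neg_one c θ with h' | h' <;> simp_all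
    rw [hF.mul_right hc0 hη0 hθ0, hcη] at hc
    rcases hilbertSymbol_eq_one_or_eq_neg_one c θ with h | h <;> rw [h] at hc <;> norm_num at hc
  obtain ⟨s, hs⟩ := hsq
  apply hθK
  refine ⟨algebraMap F K (s / η) * e QuadraticAlgebra.omega, ?_⟩
  have hω : e QuadraticAlgebra.omega * e QuadraticAlgebra.omega = algebraMap F K η := by
    rw [← map_mul, QuadraticAlgebra.omega_mul_omega_eq_mk]
    have : (⟨η, 0⟩ : QuadraticAlgebra F η 0) = algebraMap F (QuadraticAlgebra F η 0) η := by
      ext <;> simp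
    rw [this, AlgEquiv.commutes]
  have hθeq : θ = (s / η) ^ 2 * η := by field_simp; linear_combination hs
  calc algebraMap F K θ = algebraMap F K ((s / η) ^ 2 * η) := by rw [← hθeq]
    _ = algebraMap F K (s / η) * algebraMap F K (s / η) * (e QuadraticAlgebra.omega * e QuadraticAlgebra.omega) := by
        rw [hω, map_mul, map_pow, pow_two]
    _ = _ := by ring

/-- **The projection formula for the quadratic Hilbert symbol in odd or quadratic degree** over regular Hilbert fields:
`(θ, b)_K = (θ, N_{K/F} b)_F` for `θ ∈ Fˣ`, `b ∈ Kˣ`, when `[K:F]` is odd or `2`.  (`⊆`: norms of norms are norms;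
`=`: both `{b : (θ,b)_K = 1}` and `{b : (θ, N b)_F = 1}` have index `2` in `Kˣ`.)
[cite: Serre1973, Ch. III §1.2 Thm 2] [cite: Omeara1963, §63B (63:10)] -/
theorem IsRegularHilbertField.hilbertSymbol_eq_hilbertSymbol_norm (hF : IsRegularHilbertField F) (hK : IsRegularHilbertField K)
    (hdeg : Odd (Module.finrank F K) ∨ Module.finrank F K = 2) {θ : F} (hθ : θ ≠ 0) {b : K} (hb : b ≠ 0) :
    hilbertSymbol K (algebraMap F K θ) b = hilbertSymbol F θ (Algebra.norm F b) := by
  haveI : NeZero (2 : F) := ⟨hF.two_ne_zero⟩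
  haveI : NeZero (2 : K) := ⟨hK.two_ne_zero⟩
  have hθ' : algebraMap F K θ ≠ 0 := (map_ne_zero _).2 hθ
  have hNb : Algebra.norm F b ≠ 0 := Algebra.norm_ne_zero_iff.2 hb
  by_cases hsq : IsSquare (algebraMap F K θ)
  · have h1 : hilbertSymbol K (algebraMap F K θ) b = 1 := hilbertSymbol_eq_one_of_isSquare hsq hθ' b
    rw [h1, hilbertSymbol_norm_eq_one_of_eq_one hθ hb h1]
  have hχ : ∃ z : K, z ≠ 0 ∧ hilbertSymbol F θ (Algebra.norm F z) = -1 := by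
    rcases hdeg with hodd | h2
    · exact hF.exists_hilbertSymbol_norm_eq_neg_one_of_odd hθ (fun ⟨s, hs⟩ => hsq ⟨algebraMap F K s, by rw [hs, map_mul]⟩) hodd
    · exact hF.exists_hilbertSymbol_norm_eq_neg_one_of_finrank_eq_two hθ hsq h2
  obtain ⟨z, hz0, hz⟩ := hχ
  set H' : Subgroup Kˣ := (quadraticNormSubgroup F θ).comap (Units.map (Algebra.norm F : K →* F)) with hH'
  have hmem : ∀ c : Kˣ, c ∈ H' ↔ hilbertSymbol F θ (Algebra.norm F (c : K)) = 1 := by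
    intro c
    rw [hH', Subgroup.mem_comap, ← hilbertSymbol_eq_one_iff_mem_quadraticNormSubgroup hθ, Units.coe_map, hilbertSymbol_comm]
  have hle : quadraticNormSubgroup K (algebraMap F K θ) ≤ H' := fun c hc => norm_mem_quadraticNormSubgroup hc
  have hH'2 : H'.index = 2 := by
    rw [Subgroup.index_eq_two_iff]
    refine ⟨Units.mk0 z hz0, fun c => ?_⟩
    rw [hmem, hmem, Units.val_mul, Units.val_mk0, map_mul, hF.mul_right hθ (Algebra.norm_ne_zero_iff.2 c.ne_zero)
      (Algebra.norm_ne_zero_iff.2 hz0), hz]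
    rcases hilbertSymbol_eq_one_or_eq_neg_one θ (Algebra.norm F (c : K)) with h | h <;> simp [h]
  have heq := Subgroup.eq_of_le_of_index_eq_two hle (hK.index_quadraticNormSubgroup_eq_two hθ' hsq) hH'2
  have e1 : hilbertSymbol K (algebraMap F K θ) b = 1 ↔ Units.mk0 b hb ∈ quadraticNormSubgroup K (algebraMap F K θ) := by
    rw [← hilbertSymbol_eq_one_iff_mem_quadraticNormSubgroup hθ', Units.val_mk0, hilbertSymbol_comm]
  have e2 : Units.mk0 b hb ∈ H' ↔ hilbertSymbol F θ (Algebra.norm F b) = 1 := by rw [hmem, Units.val_mk0]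
  have hiff := (heq ▸ e1).trans e2
  rcases hilbertSymbol_eq_one_or_eq_neg_one (algebraMap F K θ) b with h | h <;>
    rcases hilbertSymbol_eq_one_or_eq_neg_one θ (Algebra.norm F b) with h' | h' <;> simp_all

end Regular

/-! ## §3 Completions of number fields: `(θ, b)_{L_w} = (θ, N_{L_w/K_v} b)_{K_v}` for `[L_w : K_v]` odd or `2` -/

section Completion

open NumberField IsDedekindDomain IsDedekindDomain.HeightOneSpectrum Literature.NumberTheory.AdelicBaseChange

variable (K L : Type) [Field K] [NumberField K] [Field L] [NumberField L] [Algebra K L]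
variable (v : HeightOneSpectrum (𝓞 K)) (w : v.Extension (𝓞 L))

/-- **The projection formula at a place `w ∣ v` of low degree.**  `K ⊆ L` number fields, `w ∣ v` finite places with
`[L_w : K_v]` odd or `2`, `θ ∈ K_vˣ`, `b ∈ L_wˣ`: `(θ, b)_{L_w} = (θ, N_{L_w/K_v} b)_{K_v}` (the completions are regular
Hilbert fields, O'Meara 63:13a / 63:19). [cite: Omeara1963, §63B (63:10), §63C (63:13a, 63:19)] [cite: Serre1973, Ch. III §1.2 Thm 2] -/
theorem hilbertSymbol_adicCompletion_eq_hilbertSymbol_norm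
    (hdeg : Odd (Module.finrank (v.adicCompletion K) (w.1.adicCompletion L)) ∨
      Module.finrank (v.adicCompletion K) (w.1.adicCompletion L) = 2)
    {θ : v.adicCompletion K} (hθ : θ ≠ 0) {b : w.1.adicCompletion L} (hb : b ≠ 0) :
    hilbertSymbol (w.1.adicCompletion L) (algebraMap (v.adicCompletion K) (w.1.adicCompletion L) θ) b =
      hilbertSymbol (v.adicCompletion K) θ (Algebra.norm (v.adicCompletion K) b) :=
  (isRegularHilbertField_adicCompletion K v).hilbertSymbol_eq_hilbertSymbol_norm (isRegularHilbertField_adicCompletion L w.1) hdeg hθ hb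

/-- For `[L : K] ≤ 3` every local degree `[L_w : K_v]` is `1`, `2` or `3`, hence odd or `2`. [cite: CasselsFrohlichANT1967, Ch. II §10 (10.2)] -/
theorem odd_or_eq_two_finrank_adicCompletion_of_finrank_le_three (hKL : Module.finrank K L ≤ 3) :
    Odd (Module.finrank (v.adicCompletion K) (w.1.adicCompletion L)) ∨
      Module.finrank (v.adicCompletion K) (w.1.adicCompletion L) = 2 := by
  letI := Extension.fintype (𝓞 K) K L (𝓞 L) v
  have hpos : 0 < Module.finrank (v.adicCompletion K) (w.1.adicCompletion L) := Module.finrank_pos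
  have hsum : ∑ w' : v.Extension (𝓞 L), Module.finrank (v.adicCompletion K) (w'.1.adicCompletion L) = Module.finrank K L := by
    rw [← Module.finrank_pi_fintype (v.adicCompletion K),
      ← adicCompletion.finrank_tensorProduct_adicCompletion_eq_finrank_pi_adicCompletion K L (𝓞 L) v, TensorProduct.finrank_rightAlgebra]
  have hle := ((Finset.single_le_sum (f := fun w' : v.Extension (𝓞 L) => Module.finrank (v.adicCompletion K) (w'.1.adicCompletion L))
    (fun _ _ => Nat.zero_le _) (Finset.mem_univ w)).trans hsum.le).trans hKL
  interval_cases (Module.finrank (v.adicCompletion K) (w.1.adicCompletion L)) <;> decide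

/-- **The fibre identity `∏_{w ∣ v} (θ, b_w)_{L_w} = (θ, ∏_{w ∣ v} N_{L_w/K_v} b_w)_{K_v}`** for `[L : K] ≤ 3` (e.g. an étale cubic
algebra's field factors): the projection formula place by place and the bimultiplicativity of `( , )_{K_v}`.
[cite: Omeara1963, §63B (63:10), §63C (63:13a)] -/
theorem prod_hilbertSymbol_adicCompletion_eq_hilbertSymbol_prod_norm (hKL : Module.finrank K L ≤ 3)
    {θ : v.adicCompletion K} (hθ : θ ≠ 0) (b : ∀ w' : v.Extension (𝓞 L), w'.1.adicCompletion L) (hb : ∀ w', b w' ≠ 0) :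
    letI := Extension.fintype (𝓞 K) K L (𝓞 L) v
    ∏ w' : v.Extension (𝓞 L), hilbertSymbol (w'.1.adicCompletion L) (algebraMap (v.adicCompletion K) (w'.1.adicCompletion L) θ) (b w') =
      hilbertSymbol (v.adicCompletion K) θ (∏ w' : v.Extension (𝓞 L), Algebra.norm (v.adicCompletion K) (b w')) := by
  classical
  letI := Extension.fintype (𝓞 K) K L (𝓞 L) v
  have key : ∀ s : Finset (v.Extension (𝓞 L)),
      ∏ w' ∈ s, hilbertSymbol (w'.1.adicCompletion L) (algebraMap (v.adicCompletion K) (w'.1.adicCompletion L) θ) (b w') =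
        hilbertSymbol (v.adicCompletion K) θ (∏ w' ∈ s, Algebra.norm (v.adicCompletion K) (b w')) := by
    intro s
    induction s using Finset.induction_on with
    | empty => simp [hilbertSymbol_one_right]
    | insert w' s hw' ih =>
      rw [Finset.prod_insert hw', Finset.prod_insert hw', ih,
        hilbertSymbol_adicCompletion_eq_hilbertSymbol_norm K L v w' (odd_or_eq_two_finrank_adicCompletion_of_finrank_le_three K L v w' hKL)
          hθ (hb w'),
        (isRegularHilbertField_adicCompletion K v).mul_right hθ (Algebra.norm_ne_zero_iff.2 (hb w'))
          (Finset.prod_ne_zero_iff.2 fun w'' _ => Algebra.norm_ne_zero_iff.2 (hb w''))]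
  exact key Finset.univ

end Completion

end Literature.NumberTheory.QuadraticForms

end
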